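import Literature.NumberTheory.LFunctions.CertifiedDirichletLTuringSingle
import Literature.NumberTheory.LFunctions.DirichletXiHadamardProduct
import HarnessLib

/-!
# Turing's method for Dirichlet `L`-functions: Trudgian's Lemma 3.7 and Theorem 3.8 for ONE
# primitive character, via the genus-one Hadamard product of `ξ(s, χ)` — proved

T. S. Trudgian, *Improvements to Turing's method*, Math. Comp. **80** (2011), §3.4: Lemma 3.7 (the
lower bound `−∫_{1/2}^∞ log|L(σ+it,χ)| dσ ≤ a₂ + b₂ log(qt/2π)`) rests on the Hadamard product of
`ξ(s,χ)` ("The application of Lemma 2.7 to `I₂`, with zeroes `ρ` paired with `1 − ρ̄`, gives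
`I₂ ≥ −d²(log 4) Σ_ρ Re(1/(d + ½ + it − ρ))`", arXiv:0903.1885 p. 10; Booker 2006 (4–12)–(4–13);
Rumely 1993 Lemma 2).  Until now the tree proved this only for the PAIR `Ξ_χ = ξ(·,χ)ξ(·,χ̄)`
(genus-zero product in `(s−½)²`, `CertifiedDirichletLTuringHadamard.lean`), so that the bound for a
single `∫S(t,χ)dt` carried the doubled pair constants (`CertifiedDirichletLTuringSingle.lean`:
`4.52 + 0.1284 log(qt₂/2π)`).  With the genus-ONE product of `ξ(s,χ)` (Montgomery–Vaughan Thm. 10.16,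
Cor. 10.18 and (10.38), the tree's `DirichletXiHadamardProduct.lean`, on
`Literature.Analysis.Complex.hadamard_genus_one_zeros`) the printed single-character argument goes
through verbatim:

* `TuringDirichlet.integral_log_norm_dirichletXi_sub_shift_ge` — **the zeros' part for ONE
  character**: for a primitive `χ ≠ 1`, `½ < d ≤ 1`, `t` the ordinate of no non-trivial zero of
  `L(s,χ)`, `∫_{1/2}^{1/2+d} (log|ξ(σ+it,χ)| − log|ξ(σ+d+it,χ)|) dσ ≥ −d² log 4 · Re ξ'/ξ(½+d+it, χ)`
  (the zeros `ρ` of `ξ(·,χ)` are permuted by `ρ ↦ 1 − ρ̄` WITH multiplicities; Booker's inequality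
  `booker_pair_le`, PROVED in the tree as `Trudgian2011_lemma_2_10_holds`, bounds each pair).
* `TuringDirichlet.neg_setIntegral_log_norm_LFunction_le` — **Trudgian's Lemma 3.7 for one
  character, unconditional**: `−∫_{1/2}^∞ log|L(σ+it,χ)| dσ ≤ d² log 4 (2ζ'/ζ(1+2d) − ζ'/ζ(½+d)
  + ½ log(Qt/2π) + ε'(t)) − d²(½ log(Qt/2π) − ε(t)) − I(d)` — exactly half the pair bound
  `neg_setIntegral_log_norm_LFunction_pair_le`, with the same explicit error terms
  `ε = turingEps`, `ε' = turingEps'` (first-order vertical Stirling) in place of the printed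
  `13d²/t₀²`, and Booker's `2ζ'/ζ(1+2d)` refinement.
* `TuringDirichlet.abs_pi_mul_integral_lfunctionArgS_le_hadamard` — **Trudgian's Theorem 3.8 /
  Rumely's Theorem 2, shape, for ONE primitive character**:
  `π|∫_{t₁}^{t₂} S(t,χ) dt| ≤ (a₁ + a₂) + (b₁ + b₂) log(Qt₂/2π)` for `1 ≤ t₀ < t₁ ≤ t₂`, `t₁`, `t₂`
  ordinates of no zero of `L(s,χ)` ONLY (the pair route also needed the zeros of `L(s,χ̄)`).
* `TuringDirichlet.abs_integral_lfunctionArgS_le_numeric_of_check` — numerically, for EVERY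
  primitive `χ` modulo `q > 1` and `50 < t₁ ≤ t₂`: **`|∫_{t₁}^{t₂} S(t,χ) dt| ≤ 2.26 + 0.0642 log(qt₂/2π)`**
  granted the certified `ζ` computation `trudgianCheck = true` (previously only for quadratic `χ`,
  `CertifiedDirichletLTuringReal.lean`); the hypothesis-free form (via the tree's `native_decide`
  evaluation `trudgianCheck_eq_true`) is `abs_integral_lfunctionArgS_le_numeric` in the computational
  companion file `CertifiedDirichletLTuringHadamardSingleHolds.lean`.  Printed: Rumely `1.8397 + 0.1242 log`,
  Trudgian `1.975 + 0.084 log` (typed facts `rumely1993_theorem2`, `trudgian2011_theorem33/38`; their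
  constants additionally use second-order Stirling and numerics at `(c,d) = (1.17, 0.88)`, `(1.1, 0.8)`).

## References
* T. S. Trudgian, Improvements to Turing's method, Math. Comp. 80 (2011) 2259–2279, §3.4 Lemmas
  3.6–3.7, Theorem 3.8, §2.2 Lemmas 2.7, 2.10 (arXiv:0903.1885 pp. 5–6, 9–10). [Trudgian2011]
* R. Rumely, Numerical computations concerning the ERH, Math. Comp. 61 (1993), Lemma 2, Theorem 2
  (p. 429). [Rumely1993ERH]
* A. R. Booker, Experiment. Math. 15 (2006), §4 (4–12)–(4–13), Lemma 4.4. [Booker2006]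
* H. L. Montgomery, R. C. Vaughan, Multiplicative Number Theory I, Thm. 10.16, Cor. 10.18, (10.38).
  [MontgomeryVaughan2007]
-/

noncomputable section

open Complex Set MeasureTheory intervalIntegral Filter Topology
open scoped Real ComplexConjugate

namespace Literature.NumberTheory.LFunctions

open DirichletTheta DirichletCharacter ExplicitPsiChar Trudgian2011Dirichlet TrudgianNumerics
  Literature.Analysis.Complex Literature.Analysis.Complex.HadamardGenusZero

namespace TuringDirichlet

variable {q : ℕ} [NeZero q] {χ : DirichletCharacter ℂ q}

/-! ### A uniform bound for the one-zero integrand of a far zero -/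

/-- `|log x − log y| ≤ |x − y| / min(x, y)` for `x, y > 0`. [folklore] -/
private theorem abs_log_sub_log_le {x y : ℝ} (hx : 0 < x) (hy : 0 < y) :
    |Real.log x - Real.log y| ≤ |x - y| / min x y := by
  rcases le_total x y with hle | hle
  · rw [min_eq_left hle, abs_of_nonpos (sub_nonpos.2 (Real.log_le_log hx hle)),
      abs_of_nonpos (sub_nonpos.2 hle), neg_sub, neg_sub, ← Real.log_div hy.ne' hx.ne']
    have h := Real.log_le_sub_one_of_pos (div_pos hy hx)
    have e : y / x - 1 = (y - x) / x := by field_simp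
    linarith [e ▸ h]
  · rw [min_eq_right hle, abs_of_nonneg (sub_nonneg.2 (Real.log_le_log hy hle)),
      abs_of_nonneg (sub_nonneg.2 hle), ← Real.log_div hx.ne' hy.ne']
    have h := Real.log_le_sub_one_of_pos (div_pos hx hy)
    have e : x / y - 1 = (x - y) / y := by field_simp
    linarith [e ▸ h]

/-- **The one-zero integrand of a far zero is `O(1/|ρ|²)` uniformly**: for `0 ≤ d ≤ 1`,
`σ ∈ [½, 3/2]`, `0 ≤ Re ρ ≤ 1` and `|ρ| ≥ 2(|t| + 4)`,
`|log|σ+it−ρ| − log|σ+d+it−ρ|| ≤ 8/|ρ|²` (the two distances are `≥ |ρ|/2`, and their squares differ by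
`2d(σ − Re ρ) + d² ≤ 4`). [folklore] -/
private theorem abs_gZero_le_of_norm_ge {d t σ : ℝ} {ρ : ℂ} (hd0 : 0 ≤ d) (hd1 : d ≤ 1)
    (hσ : σ ∈ Icc (1 / 2 : ℝ) (3 / 2)) (hβ0 : 0 ≤ ρ.re) (hβ1 : ρ.re ≤ 1)
    (hρ : 2 * (|t| + 4) ≤ ‖ρ‖) : |gZero d t ρ σ| ≤ 8 * ‖ρ‖⁻¹ ^ 2 := by
  set u : ℂ := (σ : ℂ) + t * I - ρ with hu
  have hu' : ((σ + d : ℝ) : ℂ) + t * I - ρ = u + d := by simp only [hu]; push_cast; ring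
  simp only [gZero]
  rw [hu', ← hu]
  -- the point `s = σ + it` and its shift are small compared with `ρ`
  have hs : ‖(σ : ℂ) + t * I‖ ≤ 3 / 2 + |t| := by
    calc ‖(σ : ℂ) + t * I‖ ≤ ‖(σ : ℂ)‖ + ‖(t : ℂ) * I‖ := norm_add_le _ _
      _ = |σ| + |t| := by simp
      _ ≤ 3 / 2 + |t| := by rw [abs_of_pos (by linarith [hσ.1])]; linarith [hσ.2]
  have hρ0 : 0 < ‖ρ‖ := by linarith [abs_nonneg t]
  have hx : ‖ρ‖ / 2 ≤ ‖u‖ := by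
    have h := norm_sub_norm_le ρ ((σ : ℂ) + t * I)
    have e : ‖ρ - ((σ : ℂ) + t * I)‖ = ‖u‖ := by rw [hu, norm_sub_rev]
    linarith
  have hy : ‖ρ‖ / 2 ≤ ‖u + d‖ := by
    have h := norm_sub_norm_le ρ ((σ : ℂ) + t * I + d)
    have e : ‖ρ - ((σ : ℂ) + t * I + d)‖ = ‖u + d‖ := by
      rw [norm_sub_rev]; congr 1; simp only [hu]; ring
    have hs' : ‖(σ : ℂ) + t * I + d‖ ≤ 5 / 2 + |t| := by
      calc ‖(σ : ℂ) + t * I + d‖ ≤ ‖(σ : ℂ) + t * I‖ + ‖(d : ℂ)‖ := norm_add_le _ _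
        _ ≤ 3 / 2 + |t| + 1 := by
            rw [Complex.norm_real, Real.norm_eq_abs, abs_of_nonneg hd0]; linarith
        _ = 5 / 2 + |t| := by ring
    linarith
  have hx0 : 0 < ‖u‖ := by linarith
  have hy0 : 0 < ‖u + d‖ := by linarith
  -- the squares differ by at most `4`
  have hre : |u.re| ≤ 3 / 2 := by
    have : u.re = σ - ρ.re := by simp [hu]
    rw [this, abs_le]; constructor <;> linarith [hσ.1, hσ.2]
  have hsq : |‖u‖ ^ 2 - ‖u + d‖ ^ 2| ≤ 4 := by
    have e : ‖u + d‖ ^ 2 = ‖u‖ ^ 2 + 2 * d * u.re + d ^ 2 := by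
      rw [Complex.sq_norm, Complex.sq_norm, Complex.normSq_add]
      simp [Complex.normSq_ofReal, mul_comm]
      ring
    rw [e, show ‖u‖ ^ 2 - (‖u‖ ^ 2 + 2 * d * u.re + d ^ 2) = -(2 * d * u.re + d ^ 2) by ring, abs_neg]
    have h1 : |2 * d * u.re| ≤ 3 := by
      rw [abs_mul, abs_of_nonneg (by positivity : (0:ℝ) ≤ 2 * d)]
      nlinarith [abs_nonneg u.re]
    have h2 : |d ^ 2| ≤ 1 := by rw [abs_of_nonneg (sq_nonneg d)]; nlinarith
    calc |2 * d * u.re + d ^ 2| ≤ |2 * d * u.re| + |d ^ 2| := abs_add_le _ _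
      _ ≤ 4 := by linarith
  -- `|x − y| = |x² − y²|/(x + y) ≤ 4/|ρ|`
  have hdiff : |‖u‖ - ‖u + d‖| ≤ 4 / ‖ρ‖ := by
    have e : ‖u‖ - ‖u + d‖ = (‖u‖ ^ 2 - ‖u + d‖ ^ 2) / (‖u‖ + ‖u + d‖) := by
      field_simp
      ring
    rw [e, abs_div, abs_of_pos (by positivity : 0 < ‖u‖ + ‖u + d‖)]
    calc |‖u‖ ^ 2 - ‖u + d‖ ^ 2| / (‖u‖ + ‖u + d‖) ≤ 4 / (‖u‖ + ‖u + d‖) := by gcongr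
      _ ≤ 4 / ‖ρ‖ := div_le_div_of_nonneg_left (by norm_num) hρ0 (by linarith)
  have hmin : ‖ρ‖ / 2 ≤ min ‖u‖ ‖u + d‖ := le_min hx hy
  calc |Real.log ‖u‖ - Real.log ‖u + d‖| ≤ |‖u‖ - ‖u + d‖| / min ‖u‖ ‖u + d‖ :=
        abs_log_sub_log_le hx0 hy0
    _ ≤ (4 / ‖ρ‖) / (‖ρ‖ / 2) := by
        gcongr
    _ = 8 * ‖ρ‖⁻¹ ^ 2 := by field_simp; ring

/-! ### The Hadamard series for `log|ξ(σ+it,χ)| − log|ξ(σ+d+it,χ)|` and its termwise integral -/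

/-- **`log|ξ(σ+it,χ)| − log|ξ(σ+d+it,χ)| = Σ_ρ g_ρ(σ)`**, `g_ρ(σ) = log|σ+it−ρ| − log|σ+d+it−ρ|`, the sum
over the zeros of `ξ(·,χ)` with multiplicity (`t` the ordinate of no zero; the genus-one Hadamard
product in modulus, `DirichletTheta.hasSum_log_norm_dirichletXi_sub`). [cite: MontgomeryVaughan2007, §10.2 Theorem 10.16 (10.32) with (10.38)] -/
theorem hasSum_gZero (hχ : χ.IsPrimitive) (h1 : χ ≠ 1) {t : ℝ}
    (hord : ∀ ρ ∈ charNontrivialZeros χ, ρ.im ≠ t) (d σ : ℝ) :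
    HasSum (fun i : ZIdx (dirichletXi χ) ↦ gZero d t i.pt σ)
      (Real.log ‖dirichletXi χ (σ + t * I)‖ - Real.log ‖dirichletXi χ ((σ + d : ℝ) + t * I)‖) := by
  have hs : dirichletXi χ ((σ : ℂ) + t * I) ≠ 0 := dirichletXi_ne_zero_of_im_eq hχ h1 hord (by simp)
  have hsd : dirichletXi χ ((σ : ℂ) + t * I + d) ≠ 0 :=
    dirichletXi_ne_zero_of_im_eq hχ h1 hord (by simp)
  have h := hasSum_log_norm_dirichletXi_sub hχ h1 hs hsd
  have e : ((σ + d : ℝ) : ℂ) + t * I = (σ : ℂ) + t * I + d := by push_cast; ring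
  rw [e]
  refine h.congr_fun fun i ↦ ?_
  have hne : (σ : ℂ) + t * I - i.pt ≠ 0 := sub_ne_zero.2 fun h' ↦ hs (h' ▸ i.f_pt)
  have hne' : (σ : ℂ) + t * I + d - i.pt ≠ 0 := sub_ne_zero.2 fun h' ↦ hsd (h' ▸ i.f_pt)
  simp only [gZero]
  rw [e, norm_div, Real.log_div (norm_ne_zero_iff.2 hne) (norm_ne_zero_iff.2 hne')]

/-- **Termwise integration**: `Σ_ρ ∫_{1/2}^{1/2+d} g_ρ(σ) dσ = ∫_{1/2}^{1/2+d} (log|ξ(σ+it,χ)| −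
log|ξ(σ+d+it,χ)|) dσ` for `0 ≤ d ≤ 1` and `t` the ordinate of no zero (dominated convergence: all but
finitely many terms are `≤ 8/|ρ|²` uniformly, `Σ 1/|ρ|² < ∞`, the others are continuous).
[cite: Trudgian2011, §3.4 proof of Lemma 3.7] -/
theorem hasSum_integral_gZero (hχ : χ.IsPrimitive) (h1 : χ ≠ 1) {d t : ℝ} (hd0 : 0 ≤ d) (hd1 : d ≤ 1)
    (hord : ∀ ρ ∈ charNontrivialZeros χ, ρ.im ≠ t) :
    HasSum (fun i : ZIdx (dirichletXi χ) ↦ ∫ σ in (1 / 2 : ℝ)..(1 / 2 + d), gZero d t i.pt σ)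
      (∫ σ in (1 / 2 : ℝ)..(1 / 2 + d),
        (Real.log ‖dirichletXi χ (σ + t * I)‖ - Real.log ‖dirichletXi χ ((σ + d : ℝ) + t * I)‖)) := by
  classical
  have hd := differentiable_dirichletXi h1
  have h0 := dirichletXi_zero_ne_zero hχ h1
  haveI : Countable (ZIdx (dirichletXi χ)) := countable_ZIdx hd h0
  have hmem := ZIdx_pt_mem_charNontrivialZeros hχ h1
  have him : ∀ i : ZIdx (dirichletXi χ), i.pt.im ≠ t := fun i ↦ hord _ (hmem i)
  have hcont : ∀ i : ZIdx (dirichletXi χ), Continuous (gZero d t i.pt) := fun i ↦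
    continuous_gZero (him i)
  -- the near zeros
  set S₀ : Finset (ZIdx (dirichletXi χ)) := idxIn hd h0 (2 * (|t| + 4)) with hS₀
  choose Cf hCf using fun i : ZIdx (dirichletXi χ) ↦
    (isCompact_Icc : IsCompact (Icc (1 / 2 : ℝ) (1 / 2 + d))).exists_bound_of_continuousOn
      (f := gZero d t i.pt) (hcont i).continuousOn
  set M : ℝ := ∑ k ∈ S₀, |Cf k| with hM
  set C : ZIdx (dirichletXi χ) → ℝ := fun i ↦ 8 * ‖i.pt‖⁻¹ ^ 2 + if i ∈ S₀ then M else 0 with hC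
  have hCsum : Summable C := by
    refine ((summable_norm_inv_sq_zeros hχ h1).mul_left 8).add
      (summable_of_ne_finset_zero (s := S₀) fun i hi ↦ ?_)
    simp [hi]
  have hbound : ∀ i, ∀ σ ∈ Icc (1 / 2 : ℝ) (1 / 2 + d), ‖gZero d t i.pt σ‖ ≤ C i := by
    intro i σ hσ
    by_cases hi : i ∈ S₀
    · have h1' : ‖gZero d t i.pt σ‖ ≤ |Cf i| := (hCf i σ hσ).trans (le_abs_self _)
      have h2' : |Cf i| ≤ M :=
        Finset.single_le_sum (f := fun k ↦ |Cf k|) (fun k _ ↦ abs_nonneg _) hi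
      have h3 : 0 ≤ 8 * ‖i.pt‖⁻¹ ^ 2 := by positivity
      simp only [hC, if_pos hi]
      linarith
    · have hfar : 2 * (|t| + 4) ≤ ‖i.pt‖ := by
        rw [hS₀, mem_idxIn, not_le] at hi; exact hi.le
      obtain ⟨-, hre0, hre1⟩ := mem_charNontrivialZeros.1 (hmem i)
      have hle := abs_gZero_le_of_norm_ge (t := t) hd0 hd1 ⟨hσ.1, by linarith [hσ.2]⟩ hre0.le hre1.le
        hfar
      simp only [hC, if_neg hi, add_zero, Real.norm_eq_abs]
      exact hle
  refine intervalIntegral.hasSum_integral_of_dominated_convergence (fun i _ ↦ C i)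
    (fun i ↦ (hcont i).aestronglyMeasurable) ?_ ?_ ?_ ?_
  · intro i
    refine Filter.Eventually.of_forall fun σ hσ ↦ hbound i σ ?_
    rw [uIoc_of_le (by linarith)] at hσ
    exact ⟨hσ.1.le, hσ.2⟩
  · exact Filter.Eventually.of_forall fun σ _ ↦ hCsum
  · exact intervalIntegrable_const
  · exact Filter.Eventually.of_forall fun σ _ ↦ hasSum_gZero hχ h1 hord d σ

/-! ### The zeros' part for ONE character -/

/-- **The zeros' part of Trudgian's lower bound for ONE primitive character** (§3.4, proof of
Lemma 3.7: "with zeroes `ρ` paired with `1 − ρ̄`, `I₂ ≥ −d²(log 4) Σ_ρ Re(1/(d + ½ + it − ρ))`", and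
`Σ_ρ Re 1/(s_d − ρ) = Re ξ'/ξ(s_d, χ)` by MV (10.36) + (10.38)): for a primitive `χ ≠ 1`, `½ < d ≤ 1`,
`t` the ordinate of no non-trivial zero of `L(s, χ)`,
`∫_{1/2}^{1/2+d} (log|ξ(σ+it,χ)| − log|ξ(σ+d+it,χ)|) dσ ≥ −d² log 4 · Re ξ'/ξ(½ + d + it, χ)`.
Unconditional (Booker's inequality is the tree's theorem `Trudgian2011_lemma_2_10_holds`).
[cite: Trudgian2011, §3.4 proof of Lemma 3.7 (application of Lemma 2.7)] -/
theorem integral_log_norm_dirichletXi_sub_shift_ge (hχ : χ.IsPrimitive) (h1 : χ ≠ 1) {d t : ℝ}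
    (hd : 1 / 2 < d) (hd1 : d ≤ 1) (hord : ∀ ρ ∈ charNontrivialZeros χ, ρ.im ≠ t) :
    -(d ^ 2 * Real.log 4 *
        (deriv (dirichletXi χ) (((1 / 2 + d : ℝ) : ℂ) + t * I) /
          dirichletXi χ (((1 / 2 + d : ℝ) : ℂ) + t * I)).re) ≤
      ∫ σ in (1 / 2 : ℝ)..(1 / 2 + d),
        (Real.log ‖dirichletXi χ (σ + t * I)‖ - Real.log ‖dirichletXi χ ((σ + d : ℝ) + t * I)‖) := by
  have hdf := differentiable_dirichletXi h1
  have h0 := dirichletXi_zero_ne_zero hχ h1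
  have hmem := ZIdx_pt_mem_charNontrivialZeros hχ h1
  have him : ∀ i : ZIdx (dirichletXi χ), i.pt.im ≠ t := fun i ↦ hord _ (hmem i)
  set sd : ℂ := ((1 / 2 + d : ℝ) : ℂ) + t * I with hsd
  have hsd0 : dirichletXi χ sd ≠ 0 := dirichletXi_ne_zero_of_im_eq hχ h1 hord (by simp [hsd])
  set I₁ : ℝ := ∫ σ in (1 / 2 : ℝ)..(1 / 2 + d),
    (Real.log ‖dirichletXi χ (σ + t * I)‖ - Real.log ‖dirichletXi χ ((σ + d : ℝ) + t * I)‖) with hI₁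
  set R : ℝ := (deriv (dirichletXi χ) sd / dirichletXi χ sd).re with hRdef
  set Φ : ZIdx (dirichletXi χ) → ℝ := fun i ↦ ∫ σ in (1 / 2 : ℝ)..(1 / 2 + d), gZero d t i.pt σ with hΦ
  set H : ZIdx (dirichletXi χ) → ℝ := fun i ↦ hZero d t i.pt with hH
  -- `Σ H = Re ξ'/ξ(s_d)` and `Σ Φ = I₁`
  have hH' : HasSum H R := by
    refine (hasSum_re_inv_sub_zeros hχ h1 hsd0).congr_fun fun i ↦ ?_
    simp only [hH, hZero, one_div, hsd]
  have hΦ' : HasSum Φ I₁ := hasSum_integral_gZero hχ h1 (by linarith) hd1 hord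
  -- the involution `ρ ↦ 1 − ρ̄` of the zeros, with multiplicities
  have hτ : Function.Involutive (fun p : ℂ × ℕ ↦ (1 - conj p.1, p.2)) := fun p ↦ by simp
  let refl : ZIdx (dirichletXi χ) ≃ ZIdx (dirichletXi χ) :=
    Equiv.subtypeEquiv hτ.toPerm fun p ↦ by
      change _ ↔ dirichletXi χ (1 - conj p.1) = 0 ∧
        p.2 < analyticOrderNatAt (dirichletXi χ) (1 - conj p.1)
      rw [analyticOrderNatAt_dirichletXi_one_sub_conj hχ h1, ← analyticOrderNatAt_ne_zero_iff hdf h0,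
        ← analyticOrderNatAt_ne_zero_iff hdf h0, analyticOrderNatAt_dirichletXi_one_sub_conj hχ h1]
  have hrefl : ∀ i : ZIdx (dirichletXi χ), (refl i).pt = 1 - conj i.pt := fun i ↦ rfl
  have hΦc : HasSum (Φ ∘ refl) I₁ := (Equiv.hasSum_iff refl).2 hΦ'
  have hHc : HasSum (H ∘ refl) R := (Equiv.hasSum_iff refl).2 hH'
  -- Booker's inequality for the pair `{ρ, 1 − ρ̄}`
  have hterm : ∀ i, -(Φ i + (Φ ∘ refl) i) ≤ d ^ 2 * Real.log 4 * (H i + (H ∘ refl) i) := by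
    intro i
    obtain ⟨-, hre0, hre1⟩ := mem_charNontrivialZeros.1 (hmem i)
    have hB := booker_pair_le Trudgian2011_lemma_2_10_holds hd hd1 hre0.le hre1.le (him i) (d := d)
    have hint : ∫ σ in (1 / 2 : ℝ)..(1 / 2 + d), (gZero d t i.pt σ + gZero d t (1 - conj i.pt) σ) =
        Φ i + (Φ ∘ refl) i := by
      simp only [hΦ, Function.comp_apply, hrefl]
      exact intervalIntegral.integral_add ((continuous_gZero (him i)).intervalIntegrable _ _)
        ((continuous_gZero (by simpa [hrefl] using him (refl i))).intervalIntegrable _ _)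
    rw [← hint]
    simp only [hH, Function.comp_apply, hrefl]
    exact hB
  have hL : HasSum (fun i ↦ -(Φ i + (Φ ∘ refl) i)) (-(I₁ + I₁)) := (hΦ'.add hΦc).neg
  have hRs : HasSum (fun i ↦ d ^ 2 * Real.log 4 * (H i + (H ∘ refl) i))
      (d ^ 2 * Real.log 4 * (R + R)) := (hH'.add hHc).mul_left _
  have key := hasSum_le hterm hL hRs
  linarith

/-! ### Trudgian's Lemma 3.7 for one character -/

omit [NeZero q] in
/-- `log(Qt/2π) = log Q + log t − log 2 − log π`. [folklore] -/
private theorem log_qt_eq₆ (hq : 0 < (q : ℝ)) {t : ℝ} (ht : 0 < t) :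
    Real.log (q * t / (2 * π)) = Real.log q + Real.log t - Real.log 2 - Real.log π := by
  rw [Real.log_div (by positivity) (by positivity), Real.log_mul hq.ne' ht.ne',
    Real.log_mul two_ne_zero Real.pi_ne_zero]
  ring

/-- `log 4 ≥ 1` (`e < 4`). [folklore] -/
private theorem one_le_log_four₆ : 1 ≤ Real.log 4 := by
  rw [Real.le_log_iff_exp_le (by norm_num)]
  have := Real.exp_one_lt_three
  linarith

/-- **Trudgian 2011, Lemma 3.7, for ONE primitive character — unconditional** (exact form up to the
explicit error terms): for `χ` primitive modulo `Q > 1`, `½ < d ≤ 1`, `t ≥ 1` the ordinate of no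
non-trivial zero of `L(s,χ)`,
`−∫_{1/2}^∞ log|L(σ+it,χ)| dσ ≤ d² log 4 (2ζ'/ζ(1+2d) − ζ'/ζ(½+d) + ½ log(Qt/2π) + ε'(t))
   − d²(½ log(Qt/2π) − ε(t)) − I(d)`,
the source's `−∫ log|L| ≤ a₂ + b₂ log(Qt/2π)`, `b₂ = (d²/2)(log 4 − 1)`, `a₂` as printed up to
`ε = turingEps`, `ε' = turingEps'` (in place of `13d²/t₀²`) and Booker's `2ζ'/ζ(1+2d) ≤ 0` refinement.
Proof as printed: the decomposition, `I(d)` and `Γ`-parts of `CertifiedDirichletLTuringLowerBound.lean`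
(`neg_setIntegral_Ioi_half_log_norm_LFunction_le_of_xi_bound`), the zeros' part
`integral_log_norm_dirichletXi_sub_shift_ge` (genus-one Hadamard product of `ξ(·,χ)`), and
`re_logDeriv_dirichletXi_shift_le`. [cite: Trudgian2011, §3.4 Lemma 3.7] -/
theorem neg_setIntegral_log_norm_LFunction_le (hq : 1 < q) (hχ : χ.IsPrimitive) {d t : ℝ}
    (hd : 1 / 2 < d) (hd1 : d ≤ 1) (ht : 1 ≤ t) (hz : ∀ ρ ∈ charNontrivialZeros χ, ρ.im ≠ t) :
    -(∫ σ in Ioi (1 / 2 : ℝ), Real.log ‖χ.LFunction (σ + t * I)‖) ≤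
      d ^ 2 * Real.log 4 *
          ((2 * (deriv riemannZeta (2 * (1 / 2 + d) : ℝ) / riemannZeta (2 * (1 / 2 + d) : ℝ)).re -
              (deriv riemannZeta (1 / 2 + d : ℝ) / riemannZeta (1 / 2 + d : ℝ)).re) +
            Real.log q / 2 + Real.log t / 2 - Real.log 2 / 2 - Real.log π / 2 + turingEps' t) -
        d ^ 2 * (Real.log q / 2 + Real.log t / 2 - Real.log 2 / 2 - Real.log π / 2 - turingEps t) -
        turingI d := by
  have hq1 : q ≠ 1 := by omega
  have h1 : χ ≠ 1 := SelbergDirichlet.ne_one_of_isPrimitive hq1 hχ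
  have hZ := integral_log_norm_dirichletXi_sub_shift_ge hχ h1 hd hd1 hz
  have hmain := neg_setIntegral_Ioi_half_log_norm_LFunction_le_of_xi_bound hχ h1 hd ht hz hZ
  have hR := re_logDeriv_dirichletXi_shift_le h1 hd hd1 ht (t := t)
  have hlog4 : 0 ≤ d ^ 2 * Real.log 4 := by
    have := one_le_log_four₆; positivity
  have hRR := mul_le_mul_of_nonneg_left hR hlog4
  linarith

/-! ### Trudgian's Theorem 3.8 for one character -/

/-- **One-sided single-character bound**: for `t₀ < u` and `t₀ < v` (`u`, `v` ordinates of no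
non-trivial zero of `L(s,χ)`; no order between `u` and `v` assumed),
`U_χ(v) − U_χ(u) ≤ (a₁ + a₂) + b₂ log(Qu/2π) + b₁ log(Qv/2π)`, `U_χ(t) = ∫_{1/2}^∞ log|L(σ+it,χ)| dσ`
(Lemma 3.6 at `v`, Lemma 3.7 at `u`). [cite: Trudgian2011, §3.4 Lemmas 3.6–3.7] -/
theorem setIntegral_log_norm_LFunction_sub_le_hadamard (hq : 1 < q) (hχ : χ.IsPrimitive)
    {c d t₀ u v : ℝ} (hc1 : 1 < c) (hc : c ≤ 5 / 4) (hd : 1 / 2 < d) (hd1 : d ≤ 1) (ht₀ : 1 ≤ t₀)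
    (hu : t₀ < u) (hv : t₀ < v)
    (hzu : ∀ ρ ∈ charNontrivialZeros χ, ρ.im ≠ u) (hzv : ∀ ρ ∈ charNontrivialZeros χ, ρ.im ≠ v) :
    (∫ σ in Ioi (1 / 2 : ℝ), Real.log ‖χ.LFunction (σ + v * I)‖) -
        ∫ σ in Ioi (1 / 2 : ℝ), Real.log ‖χ.LFunction (σ + u * I)‖ ≤
      ((729 / (2048 * t₀ ^ 2) + (c - 1 / 2) * logZeta c + ∫ σ in Ioi c, logZeta σ) +
          (d ^ 2 * Real.log 4 *
              ((2 * (deriv riemannZeta (2 * (1 / 2 + d) : ℝ) / riemannZeta (2 * (1 / 2 + d) : ℝ)).re -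
                  (deriv riemannZeta (1 / 2 + d : ℝ) / riemannZeta (1 / 2 + d : ℝ)).re) +
                turingEps' t₀) +
            d ^ 2 * turingEps t₀ - turingI d)) +
        d ^ 2 / 2 * (Real.log 4 - 1) * Real.log (q * u / (2 * π)) +
        (c - 1 / 2) ^ 2 / 4 * Real.log (q * v / (2 * π)) := by
  have hqR : (0 : ℝ) < q := by exact_mod_cast (show 0 < q by omega)
  have ht₀0 : 0 < t₀ := by linarith
  have hu1 : 1 ≤ u := by linarith
  have hu0 : 0 < u := by linarith
  have hv0 : 0 < v := by linarith
  -- Lemma 3.6 at `v`, Lemma 3.7 at `u`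
  have hU := trudgian2011_lemma36 hq hχ hc1 hc ht₀0 hv hzv
  have hL := neg_setIntegral_log_norm_LFunction_le hq hχ hd hd1 hu1 hzu
  -- monotonicity of the error terms
  have hε := turingEps_le ht₀0 hu.le
  have hε' := turingEps'_le ht₀0 hu.le
  have hlog4 : 0 ≤ d ^ 2 * Real.log 4 := by
    have := one_le_log_four₆; positivity
  have hd2 : 0 ≤ d ^ 2 := sq_nonneg d
  have hm1 := mul_le_mul_of_nonneg_left hε' hlog4
  have hm2 := mul_le_mul_of_nonneg_left hε hd2
  have hlogu := log_qt_eq₆ hqR hu0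
  have hlogv := log_qt_eq₆ hqR hv0
  rw [hlogu, hlogv]
  rw [hlogv] at hU
  linarith

/-- **Trudgian 2011, Theorem 3.8 for ONE primitive character, upper side — unconditional** (via the
genus-one Hadamard product): for `χ` primitive modulo `Q > 1`, `1 < c ≤ 5/4`, `½ < d ≤ 1`,
`1 ≤ t₀ < t₁ ≤ t₂`, `t₁`, `t₂` ordinates of no non-trivial zero of `L(s,χ)`:
`π ∫_{t₁}^{t₂} S(t,χ) dt ≤ (a₁ + a₂) + (b₁ + b₂) log(Qt₂/2π)`, `b₁ = (c−½)²/4`,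
`b₂ = (d²/2)(log 4 − 1)`, `a₁ = 729/(2048t₀²) + (c−½) log ζ(c) + ∫_c^∞ log ζ`,
`a₂ = d² log 4 (2ζ'/ζ(1+2d) − ζ'/ζ(½+d) + ε'(t₀)) + d² ε(t₀) − I(d)`.
[cite: Trudgian2011, §3.4 Theorem 3.8] -/
theorem pi_mul_integral_lfunctionArgS_le_hadamard (hq : 1 < q) (hχ : χ.IsPrimitive)
    {c d t₀ t₁ t₂ : ℝ} (hc1 : 1 < c) (hc : c ≤ 5 / 4) (hd : 1 / 2 < d) (hd1 : d ≤ 1) (ht₀ : 1 ≤ t₀)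
    (h01 : t₀ < t₁) (h12 : t₁ ≤ t₂)
    (hz₁ : ∀ ρ ∈ charNontrivialZeros χ, ρ.im ≠ t₁) (hz₂ : ∀ ρ ∈ charNontrivialZeros χ, ρ.im ≠ t₂) :
    π * ∫ t in t₁..t₂, lfunctionArgS χ t ≤
      ((729 / (2048 * t₀ ^ 2) + (c - 1 / 2) * logZeta c + ∫ σ in Ioi c, logZeta σ) +
          (d ^ 2 * Real.log 4 *
              ((2 * (deriv riemannZeta (2 * (1 / 2 + d) : ℝ) / riemannZeta (2 * (1 / 2 + d) : ℝ)).re -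
                  (deriv riemannZeta (1 / 2 + d : ℝ) / riemannZeta (1 / 2 + d : ℝ)).re) +
                turingEps' t₀) +
            d ^ 2 * turingEps t₀ - turingI d)) +
        ((c - 1 / 2) ^ 2 / 4 + d ^ 2 / 2 * (Real.log 4 - 1)) * Real.log (q * t₂ / (2 * π)) := by
  have hqR : (0 : ℝ) < q := by exact_mod_cast (show 0 < q by omega)
  have ht₁0 : 0 < t₁ := by linarith
  have h := setIntegral_log_norm_LFunction_sub_le_hadamard hq hχ hc1 hc hd hd1 ht₀ h01
    (h01.trans_le h12) hz₁ hz₂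
  rw [pi_mul_integral_lfunctionArgS_eq hχ hq h12 hz₁ hz₂]
  have hmono : Real.log (q * t₁ / (2 * π)) ≤ Real.log (q * t₂ / (2 * π)) := by
    refine Real.log_le_log (by positivity) ?_
    gcongr
  have hb : 0 ≤ d ^ 2 / 2 * (Real.log 4 - 1) := by
    have := one_le_log_four₆
    exact mul_nonneg (by positivity) (by linarith)
  have hm := mul_le_mul_of_nonneg_left hmono hb
  linarith

/-- **Trudgian 2011, Theorem 3.8 for ONE primitive character, lower side — unconditional** (roles of
`t₁`, `t₂` reversed): `−π ∫_{t₁}^{t₂} S(t,χ) dt ≤ (a₁ + a₂) + (b₁ + b₂) log(Qt₂/2π)`.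
[cite: Trudgian2011, §3.4 Theorem 3.8] -/
theorem neg_pi_mul_integral_lfunctionArgS_le_hadamard (hq : 1 < q) (hχ : χ.IsPrimitive)
    {c d t₀ t₁ t₂ : ℝ} (hc1 : 1 < c) (hc : c ≤ 5 / 4) (hd : 1 / 2 < d) (hd1 : d ≤ 1) (ht₀ : 1 ≤ t₀)
    (h01 : t₀ < t₁) (h12 : t₁ ≤ t₂)
    (hz₁ : ∀ ρ ∈ charNontrivialZeros χ, ρ.im ≠ t₁) (hz₂ : ∀ ρ ∈ charNontrivialZeros χ, ρ.im ≠ t₂) :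
    -(π * ∫ t in t₁..t₂, lfunctionArgS χ t) ≤
      ((729 / (2048 * t₀ ^ 2) + (c - 1 / 2) * logZeta c + ∫ σ in Ioi c, logZeta σ) +
          (d ^ 2 * Real.log 4 *
              ((2 * (deriv riemannZeta (2 * (1 / 2 + d) : ℝ) / riemannZeta (2 * (1 / 2 + d) : ℝ)).re -
                  (deriv riemannZeta (1 / 2 + d : ℝ) / riemannZeta (1 / 2 + d : ℝ)).re) +
                turingEps' t₀) +
            d ^ 2 * turingEps t₀ - turingI d)) +
        ((c - 1 / 2) ^ 2 / 4 + d ^ 2 / 2 * (Real.log 4 - 1)) * Real.log (q * t₂ / (2 * π)) := by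
  have hqR : (0 : ℝ) < q := by exact_mod_cast (show 0 < q by omega)
  have ht₁0 : 0 < t₁ := by linarith
  have h := setIntegral_log_norm_LFunction_sub_le_hadamard hq hχ hc1 hc hd hd1 ht₀ (h01.trans_le h12)
    h01 hz₂ hz₁
  rw [pi_mul_integral_lfunctionArgS_eq hχ hq h12 hz₁ hz₂]
  have hmono : Real.log (q * t₁ / (2 * π)) ≤ Real.log (q * t₂ / (2 * π)) := by
    refine Real.log_le_log (by positivity) ?_
    gcongr
  have hb : 0 ≤ (c - 1 / 2) ^ 2 / 4 := by positivity
  have hm := mul_le_mul_of_nonneg_left hmono hb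
  linarith

/-- **Trudgian 2011, Theorem 3.8 / Rumely 1993, Theorem 2 — shape, for ONE primitive character,
unconditional and parametric**: for `χ` primitive modulo `Q > 1`, `1 < c ≤ 5/4`, `½ < d ≤ 1`,
`1 ≤ t₀ < t₁ ≤ t₂`, `t₁`, `t₂` ordinates of no non-trivial zero of `L(s,χ)`,
`π |∫_{t₁}^{t₂} S(t,χ) dt| ≤ (a₁ + a₂) + (b₁ + b₂) log(Qt₂/2π)` — half the constants of the pair route
(`abs_pi_mul_integral_lfunctionArgS_single_le`), and with no hypothesis on the zeros of `L(s, χ̄)`.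
[cite: Trudgian2011, §3.4 Theorem 3.8] [cite: Rumely1993ERH, Theorem 2 p. 429] -/
theorem abs_pi_mul_integral_lfunctionArgS_le_hadamard (hq : 1 < q) (hχ : χ.IsPrimitive)
    {c d t₀ t₁ t₂ : ℝ} (hc1 : 1 < c) (hc : c ≤ 5 / 4) (hd : 1 / 2 < d) (hd1 : d ≤ 1) (ht₀ : 1 ≤ t₀)
    (h01 : t₀ < t₁) (h12 : t₁ ≤ t₂)
    (hz₁ : ∀ ρ ∈ charNontrivialZeros χ, ρ.im ≠ t₁) (hz₂ : ∀ ρ ∈ charNontrivialZeros χ, ρ.im ≠ t₂) :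
    π * |∫ t in t₁..t₂, lfunctionArgS χ t| ≤
      ((729 / (2048 * t₀ ^ 2) + (c - 1 / 2) * logZeta c + ∫ σ in Ioi c, logZeta σ) +
          (d ^ 2 * Real.log 4 *
              ((2 * (deriv riemannZeta (2 * (1 / 2 + d) : ℝ) / riemannZeta (2 * (1 / 2 + d) : ℝ)).re -
                  (deriv riemannZeta (1 / 2 + d : ℝ) / riemannZeta (1 / 2 + d : ℝ)).re) +
                turingEps' t₀) +
            d ^ 2 * turingEps t₀ - turingI d)) +
        ((c - 1 / 2) ^ 2 / 4 + d ^ 2 / 2 * (Real.log 4 - 1)) * Real.log (q * t₂ / (2 * π)) := by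
  have hup := pi_mul_integral_lfunctionArgS_le_hadamard hq hχ hc1 hc hd hd1 ht₀ h01 h12 hz₁ hz₂
  have hlo := neg_pi_mul_integral_lfunctionArgS_le_hadamard hq hχ hc1 hc hd hd1 ht₀ h01 h12 hz₁ hz₂
  rcases le_or_gt 0 (∫ t in t₁..t₂, lfunctionArgS χ t) with h | h
  · rw [abs_of_nonneg h]; exact hup
  · rw [abs_of_neg h, mul_neg]; exact hlo

/-! ### The numerical bound for every primitive character -/

/-- **Numerical Turing bound for ONE primitive character, granted the certified `ζ` computation**:
for `χ` primitive modulo `q > 1`, `50 < t₁ ≤ t₂` ordinates of no non-trivial zero of `L(s,χ)`,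
`|∫_{t₁}^{t₂} S(t,χ) dt| ≤ 2.26 + 0.0642 log(qt₂/2π)` (`(c, d, t₀) = (1.11, ¾, 50)`; the constants
`a₁ ≤ 2.826642`, `a₂ ≤ 4.266146`, `b₁ + b₂ ≤ 0.2016703` of `CertifiedDirichletLTuringNumerics.lean`).
[cite: Trudgian2011, §3.5] [cite: Rumely1993ERH, Theorem 2 p. 429] -/
theorem abs_integral_lfunctionArgS_le_numeric_of_check (hcheck : trudgianCheck = true)
    (hq : 1 < q) (hχ : χ.IsPrimitive) {t₁ t₂ : ℝ} (h01 : 50 < t₁) (h12 : t₁ ≤ t₂)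
    (hz₁ : ∀ ρ ∈ charNontrivialZeros χ, ρ.im ≠ t₁) (hz₂ : ∀ ρ ∈ charNontrivialZeros χ, ρ.im ≠ t₂) :
    |∫ t in t₁..t₂, lfunctionArgS χ t| ≤ 2.26 + 0.0642 * Real.log (q * t₂ / (2 * π)) := by
  obtain ⟨I1, I2, I3, I4, ok1, okZm, okZ0, -, -, -, -⟩ := bounds_of_trudgianCheck hcheck
  have e1 : ((11100 : ℕ) : ℝ) / 10 ^ 4 = 111 / 100 := by norm_num
  have e2 : ((300000 : ℕ) : ℝ) / 10 ^ 4 = 30 := by norm_num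
  have e3 : ((12500 : ℕ) : ℝ) / 10 ^ 4 = 5 / 4 := by norm_num
  have e4 : ((25000 : ℕ) : ℝ) / 10 ^ 4 = 5 / 2 := by norm_num
  have e5 : ((20000 : ℕ) : ℝ) / 10 ^ 4 = 2 := by norm_num
  have e6 : ((40000 : ℕ) : ℝ) / 10 ^ 4 = 4 := by norm_num
  have e7 : ((12498 : ℕ) : ℝ) / 10 ^ 4 = 5 / 4 - 1 / 5000 := by norm_num
  rw [e1, e2] at I1; rw [e3, e4] at I2; rw [e3, e5] at I3; rw [e6, e2] at I4
  have G : Real.log ‖riemannZeta (((111 / 100 : ℝ)) : ℂ)‖ ≤ 2.2696563886 := by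
    have := ok1.2; simp only at this; rw [e1] at this
    refine this.trans ?_; norm_num
  have GZm : Real.log ‖riemannZeta (((5 / 4 - 1 / 5000 : ℝ)) : ℂ)‖ ≤ 1.5256867400 := by
    have := okZm.2; simp only at this; rw [e7] at this
    refine this.trans ?_; norm_num
  have GZ0 : (1.5249930917 : ℝ) ≤ Real.log ‖riemannZeta (((5 / 4 : ℝ)) : ℂ)‖ := by
    rw [e3] at okZ0; refine le_trans ?_ okZ0; norm_num
  have hTB1 : ((TB1 : ℚ) : ℝ) = 1.4420089683 := by norm_num [TB1]
  have hTB2 : ((TB2 : ℚ) : ℝ) = 0.8393389420 := by norm_num [TB2]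
  have hTB3 : ((TB3 : ℚ) : ℝ) = 0.6470996291 := by norm_num [TB3]
  have hTB4 : ((TB4 : ℚ) : ℝ) = 0.1050705446 := by norm_num [TB4]
  rw [hTB1] at I1; rw [hTB2] at I2; rw [hTB3] at I3; rw [hTB4] at I4
  have hA1 := dirichletA₁_le I1 G
  have hA2 := dirichletA₂_le I2 I3 I4 GZm GZ0
  have hBc := dirichletB_le
  have hmain := abs_pi_mul_integral_lfunctionArgS_le_hadamard hq hχ (c := 111 / 100) (d := 3 / 4)
    (t₀ := 50) (by norm_num) (by norm_num) (by norm_num) (by norm_num) (by norm_num) h01 h12 hz₁ hz₂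
  have hq2 : (2 : ℝ) ≤ q := by exact_mod_cast hq
  have hL : 0 ≤ Real.log (q * t₂ / (2 * π)) := by
    refine Real.log_nonneg ?_
    rw [le_div_iff₀ (by positivity)]
    nlinarith [Real.pi_lt_d6]
  have hπ := Real.pi_gt_d6
  set S := |∫ t in t₁..t₂, lfunctionArgS χ t| with hS
  set L := Real.log (q * t₂ / (2 * π)) with hLdef
  have h1 : π * S ≤ (2.826642 + 4.266146) + 0.2016703 * L := by
    have := mul_le_mul_of_nonneg_right hBc hL
    linarith
  by_contra hcon
  rw [not_le] at hcon
  have : π * (2.26 + 0.0642 * L) < π * S := mul_lt_mul_of_pos_left hcon Real.pi_pos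
  nlinarith

end TuringDirichlet

end Literature.NumberTheory.LFunctions

end
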